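import Summits.QuantumFields.QCD.Theses.HeatSlicedQuarks

/-!
# Stub `stub_squareDissipativity` of line `Sketch`
(crux `Summit.QuantumFields.QCD.Theses.HeatSlicedQuarks.InterleavedHeatSliceFlow`, item stmt-QuantumFields-8891)

**Square dissipativity** (card square-root-dissipativity-strips, first lemma).  For a Hermitian matrix
`P`, an anti-Hermitian matrix `a` (`aᴴ = -a`) with `Σ_i ‖(a w) i‖² ≤ c² Σ_i ‖w i‖²` for every `w`, and
every vector `v`,

  `Re Σ_i conj(v i) · (((P + a)(P + a)) v) i ≥ -c² Σ_i ‖v i‖²`.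

This is the numerical-range bound `Re (P + a)² ≥ -‖a‖²` which, by Lumer–Phillips, gives
`‖exp(-s (P + a)²)‖ ≤ e^{s c²}`: a heat slice at proper time `t` tolerates a non-Hermitian perturbation
of size `t^{-1/2}`.

Proof.  Put `M = P + a`; then `Mᴴ = P - a` and
`Σ_i conj(v i) (M M v) i = ⟨Mᴴ v, M v⟩ = ⟨P v - a v, P v + a v⟩
  = ⟨Pv, Pv⟩ + ⟨Pv, av⟩ - ⟨av, Pv⟩ - ⟨av, av⟩`.
The two middle terms are complex conjugates of each other, so they have the same real part and cancel
in `Re`; hence the real part equals `‖Pv‖² - ‖av‖² ≥ -‖av‖² ≥ -c² ‖v‖²`.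
No named facts are used (Mathlib only).
-/

namespace Summit.QuantumFields.QCD.Cruxes.InterleavedHeatSliceFlow.Sketch

open Matrix

/-- `Re⟨v, v⟩ = Σ_i ‖v i‖²` for a complex vector `v`. -/
private theorem squareDissipativity_re_star_dotProduct_self {n : Type*} [Fintype n] (v : n → ℂ) :
    (star v ⬝ᵥ v).re = ∑ i, ‖v i‖ ^ 2 := by
  rw [dotProduct, Complex.re_sum]
  refine Finset.sum_congr rfl fun i _ => ?_
  rw [Pi.star_apply, Complex.star_def, ← Complex.normSq_eq_conj_mul_self, Complex.ofReal_re,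
    Complex.normSq_eq_norm_sq]

/-- `Re⟨x, y⟩ = Re⟨y, x⟩` for complex vectors `x`, `y` (the pairing is Hermitian). -/
private theorem squareDissipativity_re_star_dotProduct_comm {n : Type*} [Fintype n]
    (x y : n → ℂ) : (star x ⬝ᵥ y).re = (star y ⬝ᵥ x).re := by
  rw [star_dotProduct, Complex.star_def, Complex.conj_re]

/-- `⟨v, M w⟩ = ⟨Mᴴ v, w⟩`: moving a square complex matrix across the sesquilinear pairing. -/
private theorem squareDissipativity_star_dotProduct_mulVec {n : Type*} [Fintype n]
    (M : Matrix n n ℂ) (v w : n → ℂ) :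
    star v ⬝ᵥ (M *ᵥ w) = star (Mᴴ *ᵥ v) ⬝ᵥ w := by
  rw [dotProduct_mulVec, star_mulVec, conjTranspose_conjTranspose]

/-- **Square dissipativity** (registered stub `stub_squareDissipativity` of line `Sketch`; card
square-root-dissipativity-strips, first lemma): for `P` Hermitian, `a` anti-Hermitian (`aᴴ = -a`) with
`Σ_i ‖(a w) i‖² ≤ c² Σ_i ‖w i‖²` for all `w`, and every `v`,
`-c² Σ_i ‖v i‖² ≤ Re Σ_i conj(v i) · (((P + a)(P + a)) v) i`.
Indeed `Σ_i conj(v i) ((P+a)(P+a) v) i = ⟨(P - a) v, (P + a) v⟩ = ‖Pv‖² - ‖av‖² + (z - conj z)` with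
`z = ⟨Pv, av⟩`, whose last bracket is purely imaginary; and `‖av‖² ≤ c² ‖v‖²`. -/
theorem stub_squareDissipativity :
    ∀ (ι : Type) [Fintype ι] [DecidableEq ι] (P a : Matrix ι ι ℂ) (c : ℝ),
      P.IsHermitian → aᴴ = -a →
      (∀ w : ι → ℂ, ∑ i, ‖a.mulVec w i‖ ^ 2 ≤ c ^ 2 * ∑ i, ‖w i‖ ^ 2) →
      ∀ v : ι → ℂ,
        -(c ^ 2 * ∑ i, ‖v i‖ ^ 2) ≤ (∑ i, star (v i) * ((P + a) * (P + a)).mulVec v i).re := by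
  intro ι _ _ P a c hP ha hc v
  -- the sum is the sesquilinear pairing `⟨v, (P + a)(P + a) v⟩`
  have hsum : ∑ i, star (v i) * ((P + a) * (P + a)).mulVec v i =
      star v ⬝ᵥ (((P + a) * (P + a)) *ᵥ v) := rfl
  -- the adjoint of `P + a` is `P - a`
  have hadj : (P + a)ᴴ = P - a := by
    rw [conjTranspose_add, hP.eq, ha, sub_eq_add_neg]
  -- expand `⟨(P - a) v, (P + a) v⟩`
  have hpair : star v ⬝ᵥ (((P + a) * (P + a)) *ᵥ v) =
      star (P *ᵥ v) ⬝ᵥ (P *ᵥ v) + star (P *ᵥ v) ⬝ᵥ (a *ᵥ v)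
        - star (a *ᵥ v) ⬝ᵥ (P *ᵥ v) - star (a *ᵥ v) ⬝ᵥ (a *ᵥ v) := by
    rw [← mulVec_mulVec, squareDissipativity_star_dotProduct_mulVec, hadj, sub_mulVec, add_mulVec,
      star_sub, sub_dotProduct, dotProduct_add, dotProduct_add]
    ring
  rw [hsum, hpair, Complex.sub_re, Complex.sub_re, Complex.add_re,
    squareDissipativity_re_star_dotProduct_comm (P *ᵥ v) (a *ᵥ v),
    squareDissipativity_re_star_dotProduct_self, squareDissipativity_re_star_dotProduct_self]
  have hPv : 0 ≤ ∑ i, ‖(P *ᵥ v) i‖ ^ 2 := Finset.sum_nonneg fun _ _ => by positivity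
  have hav : ∑ i, ‖(a *ᵥ v) i‖ ^ 2 ≤ c ^ 2 * ∑ i, ‖v i‖ ^ 2 := hc v
  linarith

end Summit.QuantumFields.QCD.Cruxes.InterleavedHeatSliceFlow.Sketch
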